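import Literature.NumberTheory.Transcendental.RoySmallValueDivision
import Mathlib.Algebra.Order.Antidiag.Finsupp
import HarnessLib

/-!
# Roy's small value estimate for `𝔾ₐ × 𝔾ₘ` — Proposition 3.7 (division with length control)

Topic `Literature/NumberTheory/Transcendental`. Part of the formalisation of the proof of Roy 2013,
Theorem 1.1 (named fact `roy2013_thm_1_1`, `RoySmallValueEstimates.lean`). Source: D. Roy,
*A small value estimate for `𝔾ₐ × 𝔾ₘ`*, Mathematika 59 (2013) 333–363 = arXiv:1301.0663, §3,
Proposition 3.7 (p. 10 of the arXiv text):

> **Proposition 3.7.** Let `γ = (ξ, η) ∈ 𝒢`, `D, T ∈ ℕ*` with `3 ≤ D` and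
> `1 ≤ T ≤ binom(⌊D/3⌋+1, 2)`. For any `N ≥ D` and `Q ∈ I_N^{(γ,T)}` we can write
> `Q = ∑_{|ν| = N-D} X^ν P_ν` with `P_ν ∈ I_D^{(γ,T)}` and
> `∑ 𝓛(P_ν) ≤ c₃(γ)^{2N} N^{6T log N} 𝓛(Q)`.

Roy's proof is a recursion on `N` through Lemma 3.5 with `K = D` if `N ≤ (3D+2)/2` and
`K = ⌊2N/3⌋` otherwise, of depth `O(log(N/D))`; the factor `N^{6T log N}` is the product of the
`(64K)^T N`-type factors of Lemma 3.5 along the recursion. We formalise exactly this recursion,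
but index the estimate by the DEPTH `k` of the recursion instead of `log N`
(`prop_3_7_depth`): if `2^k N ≤ 3^k D` (so that at most `k` division steps are needed) then
`∑ 𝓛(P_ν) ≤ Λ(N, T)^k 𝓛(Q)` with `Λ(N, T) = 3 (c₁'c₂)^N (16N³)^T` the constant of our
`lemma_3_5` (`c₁' = 3(1 + |ξ| + |η|⁻¹)`, `c₂ = max{1, |ξ|, |η|}`). Taking
`k ≍ log(N/D) / log(3/2)` recovers a bound of Roy's shape `c(γ)^{O(N log N)} N^{O(T log N)}`, which
is all that is used later (Lemma 4.4, Proposition 4.5, and Step 2 of §7, where it appears as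
`T^{-7T log T}`). The hypothesis `T ≤ binom(⌊D/3⌋+1, 2)` enters, as printed, only through
`D ≥ 3(L+1)` for the `L` with `binom(L+1, 2) < T ≤ binom(L+2, 2)`; we take `L` and these two
inequalities as data. "Collecting terms" after the recursive call is `exists_recombine`.

Everything here is proved; no definitions, no new named facts.

## References

* [Roy2013] D. Roy, *A small value estimate for 𝔾ₐ × 𝔾ₘ*, Mathematika 59 (2013), 333–363
  (arXiv:1301.0663), §3, Proposition 3.7.
-/

noncomputable section

open MvPolynomial Finset

namespace Literature.NumberTheory.Transcendental

namespace Roy2013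

open Nesterenko

/-! ### Exponents of a given degree -/

/-- Membership in `finsuppAntidiag univ n`: the exponents `ν ∈ ℕ³` with `|ν| = n`. [folklore] -/
theorem mem_finsuppAntidiag_univ {n : ℕ} {ν : Fin 3 →₀ ℕ} :
    ν ∈ finsuppAntidiag (univ : Finset (Fin 3)) n ↔ ν.degree = n := by
  rw [mem_finsuppAntidiag, Finsupp.degree_eq_sum]
  simp

/-! ### Collecting terms -/

/-- **Collecting terms** (proof of Proposition 3.7): if `Q_j = ∑_{|μ|=K-D} X^μ P_{j,μ}` for
`j = 0, 1, 2` with `P_{j,μ} ∈ I_D^{(γ,T)}` and `∑_μ 𝓛(P_{j,μ}) ≤ B_j`, then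
`∑_j X_j^{N-K} Q_j = ∑_{|ν|=N-D} X^ν P_ν` with `P_ν ∈ I_D^{(γ,T)}` and `∑ 𝓛(P_ν) ≤ ∑ B_j`.
[cite: Roy2013, §3, proof of Proposition 3.7] -/
theorem exists_recombine {ξ η : ℂ} {T D K N : ℕ} (hDK : D ≤ K) (hKN : K ≤ N)
    (Qj : Fin 3 → CX) (B : Fin 3 → ℝ)
    (hdec : ∀ j, ∃ P : (Fin 3 →₀ ℕ) → CX,
      (∀ μ ∈ finsuppAntidiag (univ : Finset (Fin 3)) (K - D),
        (P μ).IsHomogeneous D ∧ P μ ∈ vanIdeal ξ η T) ∧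
      ∑ μ ∈ finsuppAntidiag (univ : Finset (Fin 3)) (K - D), monomial μ (1 : ℂ) * P μ = Qj j ∧
      ∑ μ ∈ finsuppAntidiag (univ : Finset (Fin 3)) (K - D), l1Norm (P μ) ≤ B j) :
    ∃ P : (Fin 3 →₀ ℕ) → CX,
      (∀ ν ∈ finsuppAntidiag (univ : Finset (Fin 3)) (N - D),
        (P ν).IsHomogeneous D ∧ P ν ∈ vanIdeal ξ η T) ∧
      ∑ ν ∈ finsuppAntidiag (univ : Finset (Fin 3)) (N - D), monomial ν (1 : ℂ) * P ν =
        ∑ j, X j ^ (N - K) * Qj j ∧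
      ∑ ν ∈ finsuppAntidiag (univ : Finset (Fin 3)) (N - D), l1Norm (P ν) ≤ ∑ j, B j := by
  classical
  choose P' hP' hsum hlen using hdec
  set EK := finsuppAntidiag (univ : Finset (Fin 3)) (K - D) with hEK
  set EN := finsuppAntidiag (univ : Finset (Fin 3)) (N - D) with hEN
  -- the shift `μ ↦ (N-K) e_j + μ` maps `EK` into `EN`
  set g : Fin 3 → (Fin 3 →₀ ℕ) → (Fin 3 →₀ ℕ) := fun j μ => Finsupp.single j (N - K) + μ with hg
  have hmaps : ∀ j, ∀ μ ∈ EK, g j μ ∈ EN := by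
    intro j μ hμ
    rw [hEK, mem_finsuppAntidiag_univ] at hμ
    rw [hEN, mem_finsuppAntidiag_univ, hg]
    dsimp only
    rw [map_add, Finsupp.degree_single, hμ]
    omega
  refine ⟨fun ν => ∑ j, ∑ μ ∈ EK with g j μ = ν, P' j μ, fun ν _ => ⟨?_, ?_⟩, ?_, ?_⟩
  · -- homogeneity
    refine (homogeneousSubmodule (Fin 3) ℂ D).sum_mem fun j _ =>
      (homogeneousSubmodule (Fin 3) ℂ D).sum_mem fun μ hμ => ?_
    exact (hP' j μ (mem_filter.mp hμ).1).1
  · -- vanishing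
    refine Ideal.sum_mem _ fun j _ => Ideal.sum_mem _ fun μ hμ => ?_
    exact (hP' j μ (mem_filter.mp hμ).1).2
  · -- the identity
    calc ∑ ν ∈ EN, monomial ν (1 : ℂ) * ∑ j, ∑ μ ∈ EK with g j μ = ν, P' j μ
        = ∑ j, ∑ ν ∈ EN, ∑ μ ∈ EK with g j μ = ν, monomial (g j μ) (1 : ℂ) * P' j μ := by
          rw [Finset.sum_comm]
          refine Finset.sum_congr rfl fun ν _ => ?_
          rw [Finset.mul_sum]
          refine Finset.sum_congr rfl fun j _ => ?_
          rw [Finset.mul_sum]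
          refine Finset.sum_congr rfl fun μ hμ => ?_
          rw [(mem_filter.mp hμ).2]
      _ = ∑ j, ∑ μ ∈ EK, monomial (g j μ) (1 : ℂ) * P' j μ :=
          Finset.sum_congr rfl fun j _ => sum_fiberwise_of_maps_to (hmaps j) _
      _ = ∑ j, X j ^ (N - K) * Qj j := by
          refine Finset.sum_congr rfl fun j _ => ?_
          rw [← hsum j, Finset.mul_sum]
          refine Finset.sum_congr rfl fun μ _ => ?_
          rw [hg]
          dsimp only
          rw [X_pow_eq_monomial, ← mul_assoc, monomial_mul, one_mul]
  · -- the lengths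
    calc ∑ ν ∈ EN, l1Norm (∑ j, ∑ μ ∈ EK with g j μ = ν, P' j μ)
        ≤ ∑ ν ∈ EN, ∑ j, ∑ μ ∈ EK with g j μ = ν, l1Norm (P' j μ) :=
          Finset.sum_le_sum fun ν _ => (l1Norm_sum_le _ _).trans
            (Finset.sum_le_sum fun j _ => l1Norm_sum_le _ _)
      _ = ∑ j, ∑ μ ∈ EK, l1Norm (P' j μ) := by
          rw [Finset.sum_comm]
          exact Finset.sum_congr rfl fun j _ => sum_fiberwise_of_maps_to (hmaps j) _
      _ ≤ ∑ j, B j := Finset.sum_le_sum fun j _ => hlen j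

/-! ### The trivial decomposition at `N = D` -/

/-- At `N = D` the decomposition is `Q = X^0 · Q`. [folklore] -/
theorem exists_decomposition_self {ξ η : ℂ} {T D : ℕ} {Q : CX} (hQ : Q.IsHomogeneous D)
    (hQv : Q ∈ vanIdeal ξ η T) {Λ : ℝ} (hΛ : 1 ≤ Λ) :
    ∃ P : (Fin 3 →₀ ℕ) → CX,
      (∀ ν ∈ finsuppAntidiag (univ : Finset (Fin 3)) (D - D),
        (P ν).IsHomogeneous D ∧ P ν ∈ vanIdeal ξ η T) ∧
      ∑ ν ∈ finsuppAntidiag (univ : Finset (Fin 3)) (D - D), monomial ν (1 : ℂ) * P ν = Q ∧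
      ∑ ν ∈ finsuppAntidiag (univ : Finset (Fin 3)) (D - D), l1Norm (P ν) ≤ Λ * l1Norm Q := by
  refine ⟨fun _ => Q, fun ν _ => ⟨hQ, hQv⟩, ?_, ?_⟩
  · rw [Nat.sub_self, finsuppAntidiag_zero, sum_singleton, monomial_zero', C_1, one_mul]
  · rw [Nat.sub_self, finsuppAntidiag_zero, sum_singleton]
    exact le_mul_of_one_le_left (l1Norm_nonneg _) hΛ

/-! ### Proposition 3.7 -/

/-- **Roy 2013, Proposition 3.7** (division with length control), depth-indexed form. Let
`γ = (ξ, η)` with `η ≠ 0`, `L, T, D ∈ ℕ` with `binom(L+1,2) < T ≤ binom(L+2,2)` and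
`3(L+1) ≤ D` (these hold when `3 ≤ D` and `1 ≤ T ≤ binom(⌊D/3⌋+1, 2)`, as printed). Let
`k, N ∈ ℕ` with `D ≤ N` and `2^k N ≤ 3^k D`, and let `Q ∈ I_N^{(γ,T)}`. Then
`Q = ∑_{|ν|=N-D} X^ν P_ν` with `P_ν ∈ I_D^{(γ,T)}` and `∑ 𝓛(P_ν) ≤ Λ(N,T)^k 𝓛(Q)`,
`Λ(N,T) = 3(c₁'c₂)^N (16N³)^T` (Roy: `≤ c₃^{2N} N^{6T log N} 𝓛(Q)`; here `k` plays the role of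
`log N`, the recursion being the printed one: `K = D` if `2N ≤ 3D+2`, else `K = ⌊2N/3⌋`).
[cite: Roy2013, Proposition 3.7] -/
theorem prop_3_7_depth {ξ η : ℂ} (hη : η ≠ 0) {L T D : ℕ} (hT₁ : (L + 1).choose 2 < T)
    (hT₂ : T ≤ (L + 2).choose 2) (hD : 3 * (L + 1) ≤ D) :
    ∀ (k N : ℕ), D ≤ N → 2 ^ k * N ≤ 3 ^ k * D → ∀ {Q : CX}, Q.IsHomogeneous N →
      Q ∈ vanIdeal ξ η T →
      ∃ P : (Fin 3 →₀ ℕ) → CX,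
        (∀ ν ∈ finsuppAntidiag (univ : Finset (Fin 3)) (N - D),
          (P ν).IsHomogeneous D ∧ P ν ∈ vanIdeal ξ η T) ∧
        ∑ ν ∈ finsuppAntidiag (univ : Finset (Fin 3)) (N - D), monomial ν (1 : ℂ) * P ν = Q ∧
        ∑ ν ∈ finsuppAntidiag (univ : Finset (Fin 3)) (N - D), l1Norm (P ν) ≤
          (3 * (3 * (1 + ‖ξ‖ + ‖η‖⁻¹) * max 1 (max ‖ξ‖ ‖η‖)) ^ N * (16 * (N : ℝ) ^ 3) ^ T) ^ k *
            l1Norm Q := by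
  -- the constant `Λ(N, T)` and its monotonicity
  set c : ℝ := 3 * (1 + ‖ξ‖ + ‖η‖⁻¹) * max 1 (max ‖ξ‖ ‖η‖) with hc
  have hc1 : 1 ≤ c := by
    have h1 : 0 ≤ ‖ξ‖ := norm_nonneg _
    have h2 : 0 ≤ ‖η‖⁻¹ := inv_nonneg.mpr (norm_nonneg _)
    have h3 : 1 ≤ max 1 (max ‖ξ‖ ‖η‖) := le_max_left _ _
    rw [hc]; nlinarith
  have hΛ1 : ∀ N : ℕ, 1 ≤ N → (1 : ℝ) ≤ 3 * c ^ N * (16 * (N : ℝ) ^ 3) ^ T := by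
    intro N hN
    have hN' : (1 : ℝ) ≤ N := by exact_mod_cast hN
    have h1 : (1 : ℝ) ≤ c ^ N := one_le_pow₀ hc1
    have h2 : (1 : ℝ) ≤ (16 * (N : ℝ) ^ 3) ^ T :=
      one_le_pow₀ (by nlinarith [one_le_pow₀ (n := 3) hN'])
    nlinarith
  have hΛmono : ∀ K N : ℕ, 1 ≤ K → K ≤ N →
      3 * c ^ K * (16 * (K : ℝ) ^ 3) ^ T ≤ 3 * c ^ N * (16 * (N : ℝ) ^ 3) ^ T := by
    intro K N hK hKN
    have hKN' : (K : ℝ) ≤ N := by exact_mod_cast hKN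
    gcongr
  intro k
  induction k with
  | zero =>
    intro N hDN hk Q hQ hQv
    rw [pow_zero, one_mul, pow_zero, one_mul] at hk
    obtain rfl : N = D := le_antisymm hk hDN
    simpa using exists_decomposition_self hQ hQv le_rfl
  | succ k ih =>
    intro N hDN hk Q hQ hQv
    have hD1 : 1 ≤ D := by omega
    -- the choice of `K`
    obtain ⟨K, hDK, hKN, hN₁, hN₂, hk'⟩ : ∃ K, D ≤ K ∧ K ≤ N ∧ N + L ≤ 2 * K ∧
        2 * N ≤ 3 * K + 2 ∧ 2 ^ k * K ≤ 3 ^ k * D := by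
      by_cases hcase : 2 * N ≤ 3 * D + 2
      · refine ⟨D, le_rfl, hDN, by omega, hcase, ?_⟩
        exact Nat.mul_le_mul_right _ (Nat.pow_le_pow_left (by norm_num) k)
      · refine ⟨2 * N / 3, by omega, by omega, by omega, by omega, ?_⟩
        have h3 : 3 * (2 ^ k * (2 * N / 3)) ≤ 3 * (3 ^ k * D) := by
          calc 3 * (2 ^ k * (2 * N / 3)) = 2 ^ k * (3 * (2 * N / 3)) := by ring
            _ ≤ 2 ^ k * (2 * N) := Nat.mul_le_mul_left _ (Nat.mul_div_le (2 * N) 3)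
            _ = 2 ^ (k + 1) * N := by ring
            _ ≤ 3 ^ (k + 1) * D := hk
            _ = 3 * (3 ^ k * D) := by ring
        exact Nat.le_of_mul_le_mul_left h3 (by norm_num)
    have hLK : L < K := by omega
    have hK1 : 1 ≤ K := by omega
    -- Lemma 3.5
    obtain ⟨Q₀, Q₁, Q₂, ⟨hh₀, hh₁, hh₂⟩, ⟨hv₀, hv₁, hv₂⟩, hsum, hlen⟩ :=
      lemma_3_5 hη hT₁ hT₂ hLK hKN hN₁ hN₂ hQ hQv
    -- the recursive call at level `K`
    set Qj : Fin 3 → CX := ![Q₀, Q₁, Q₂] with hQj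
    have hQjh : ∀ j, (Qj j).IsHomogeneous K := by
      intro j; fin_cases j <;> assumption
    have hQjv : ∀ j, Qj j ∈ vanIdeal ξ η T := by
      intro j; fin_cases j <;> assumption
    obtain ⟨P, hP, hPsum, hPlen⟩ := exists_recombine (ξ := ξ) (η := η) (T := T) hDK hKN Qj
      (fun j => (3 * c ^ K * (16 * (K : ℝ) ^ 3) ^ T) ^ k * l1Norm (Qj j))
      (fun j => ih K hDK hk' (hQjh j) (hQjv j))
    refine ⟨P, hP, ?_, hPlen.trans ?_⟩
    · rw [hPsum, Fin.sum_univ_three, ← hsum]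
      simp [hQj]
    · rw [Fin.sum_univ_three]
      have hl : l1Norm (Qj 0) + l1Norm (Qj 1) + l1Norm (Qj 2) ≤
          3 * c ^ K * (16 * (K : ℝ) ^ 3) ^ T * l1Norm Q := by simpa [hQj] using hlen
      have hmono := hΛmono K N hK1 hKN
      have hΛK := hΛ1 K hK1
      have hQ0 : 0 ≤ l1Norm Q := l1Norm_nonneg _
      calc (3 * c ^ K * (16 * (K : ℝ) ^ 3) ^ T) ^ k * l1Norm (Qj 0) +
            (3 * c ^ K * (16 * (K : ℝ) ^ 3) ^ T) ^ k * l1Norm (Qj 1) +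
            (3 * c ^ K * (16 * (K : ℝ) ^ 3) ^ T) ^ k * l1Norm (Qj 2)
          = (3 * c ^ K * (16 * (K : ℝ) ^ 3) ^ T) ^ k *
              (l1Norm (Qj 0) + l1Norm (Qj 1) + l1Norm (Qj 2)) := by ring
        _ ≤ (3 * c ^ K * (16 * (K : ℝ) ^ 3) ^ T) ^ k *
              (3 * c ^ K * (16 * (K : ℝ) ^ 3) ^ T * l1Norm Q) :=
            mul_le_mul_of_nonneg_left hl (by positivity)
        _ = (3 * c ^ K * (16 * (K : ℝ) ^ 3) ^ T) ^ (k + 1) * l1Norm Q := by ring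
        _ ≤ (3 * c ^ N * (16 * (N : ℝ) ^ 3) ^ T) ^ (k + 1) * l1Norm Q := by
            gcongr

end Roy2013

end Literature.NumberTheory.Transcendental
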